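/-
Copyright (c) 2026 the pub-hodgecm-mathlib formalisation cell (harness21).  Prover seat hodgecm-mathlib-F0P3a-p01 (g22), 2026-09-02.
-/
import Summits.HodgeConjecture.HodgeConjecture.Theorems.F0P3cStCharTSUpTrU2Chart      -- ★ (B1) LH7-p02 (g8): `mem_unitaryGroupOfForm_two_iff`, `coe_inv_eq_of_mem`, `exists_upper ∕ exists_lower ∕ exists_diag`, `upper_mul_lower`, `eq_lower_mul_diag_mul_upper`, the torus twists
import Summits.HodgeConjecture.HodgeConjecture.Theorems.F0P3cStCharTSUpTrU2Levels     -- ★ (B2a) LH4-p03 (g9): `injOn_nbar_torus_unipotent` (brings ★ U2Alg `coe_weylConj_apply`, `weylLongU_inv_eq`, `congruenceGL`)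
import HarnessLib

/-!
# F0 · P3c · line LH6 «StCharTS» — ROAD «UP-TR» ∕ «JAC-LOC₂», brick (B2b) «IWAHORI-TYPE BOX PRODUCT»: the bare product `N̄[r₁] · M_δ · N[r₂]` of the lower box, the torus
# level and the upper box of `U(σ, Φ₂)(K)` IS A SUBGROUP whenever `r₁ r₂ ≤ δ < 1` [Casselman1995, Prop. 1.4.4; BruhatTits1972, (4.4.3)–(4.4.4); Rogawski1990, §1.10]

Cell `pub/hodgecm-mathlib`, crux H413 = `stmt-HodgeConjecture-24833` (lane `--supports … --as helper`, route HCCMUnconditional); seat F0P3a-p01 (g22).  ROAD «UP-TR» (LEAD F0P3a-plan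
(g15) T14-21 «A»; holder F0P3-p02 (g23)); sub-road «JAC-LOC₂» ((H4s) JAC-H-SPLIT, sub-dealer LH7-p02 (g8), DEAL #3 2026-09-02T18:39:41Z ∕ ruling 18:42:25Z: «(B2b) = Iwahori-type
`P(r₁,δ,r₂)` SUBGROUP + index lemma», convention `N̄·M·N`, A1 «bare product, NO `K_ε` factor»).  THEOREMS ONLY (no definition ∕ instance ∕ notation ∕ named fact ∕ `sorry`); ★-only imports.

SETTING ((B1)'s, verbatim): `K` a field with a `ValuativeRel` (`v = valuation K`), `σ : K →+* K` an ISOMETRIC ring endomorphism (`hσv`; NO involution hypothesis is needed), `J = Φ₂ = antidiag(1,1)`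
(`hJ : J = (StdForm.antidiagonal 2).over K`), `U′ = ↥(unitaryGroupOfForm σ J)`.  The three BOX CARRIERS are spelled by MATRIX SHAPE, exactly as in the (B5) letter
`…UpTrU2OrbitTube.conj_mul_mem_orbitTube`:
  `N̄[r] = {x : U′ | ↑↑x = !![1, 0; (↑↑x) 1 0, 1] ∧ v ((↑↑x) 1 0) ≤ r}`, `M_δ = {m : U′ | m ∈ torusU σ J ∧ ↑m ∈ congruenceGL 2 δ}`, `N[r] = {x : U′ | ↑↑x = !![1, (↑↑x) 0 1; 0, 1] ∧ v ((↑↑x) 0 1) ≤ r}`.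
* §1 shapes (skew coordinates `y + σ y = 0`, products, inverses, torus-level entries of valuation one); §2 the torus TWISTS preserve the boxes
  (`conj_mem_upperBox_of_mem_torusLevel`, `…lowerBox…`; ★ (B1) §4); §3 THE REFACTORISATION `u(y)·ū(z) = ū(z p′)·m(1 + yz, 1 − z p′ y)·u(p′ y)`, `p′(1 + yz) = 1`,
  with bounds (`exists_refactor_upper_mul_lower`; ★ (B1) `upper_mul_lower`, `eq_lower_mul_diag_mul_upper`, `exists_lower ∕ exists_diag ∕ exists_upper`);
  §4 **`exists_subgroup_coe_eq_boxProduct (hδ : δ < 1) (hr : r₁ * r₂ ≤ δ) : ∃ P : Subgroup U′, (P : Set U′) = N̄[r₁] * M_δ * N[r₂]`** (only the product `r₁ r₂` enters);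
  FILE 3 (`…UpTrU2BoxProductIndex`): bridges to the subgroup spellings (`N̄ = w₀Nw₀`, `M`, `N`), unique factorisation on `N̄[r₁] × M_δ × N[r₂]` (★ (B2a) `injOn_nbar_torus_unipotent`)
  and the INDEX LEMMA `[P(r₁,δ,r₂) : P(r₁′,δ,r₂′)] = [N̄[r₁] : N̄[r₁′]]·[N[r₂] : N[r₂′]]` as the instance of ★ `Literature.GroupTheory.ProductSubgroupIndex.relIndex_tripleProduct_eq` ((B2b) FILE 1).
HONEST LABEL (ROAD «UP-TR», LEAD T14-21 (7)): count-neutral; block consequents 11 → 10 → 9 only at the rider editions; organs 2 = 2; h413 registry untouched; HC_CM is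
proved only modulo the printed citations (2 remaining named inputs: hLiu418 = `stmt-HodgeConjecture-24832`, h413 = `stmt-HodgeConjecture-24833`) until rung 0 closes.

## References
* [Casselman1995] W. Casselman, *Introduction to the theory of admissible representations of `p`-adic reductive groups* (draft 1 May 1995), Prop. 1.4.4 (Iwahori factorisation;
  the groups `N̄_a M_b N_c`).
* [BruhatTits1972] F. Bruhat, J. Tits, *Groupes réductifs sur un corps local I*, Publ. Math. IHÉS 41 (1972), (4.4.3)–(4.4.4), §6.4 (groups with an Iwahori factorisation).
* [Rogawski1990] J. D. Rogawski, *Automorphic Representations of Unitary Groups in Three Variables*, Ann. of Math. Stud. 123 (1990), §1.9 p. 8, §1.10 p. 9 (`U(1,1)`, `B = MN`).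
-/

set_option autoImplicit false
-- the mandated namespace has the single-problem summit's repeated segment (`HodgeConjecture.HodgeConjecture`)
set_option linter.dupNamespace false

open Matrix ValuativeRel
open Literature.NumberTheory.Automorphic Literature.NumberTheory.Automorphic.UnitaryGroup
open Summit.HodgeConjecture.HodgeConjecture.Cruxes.H413.F0P3cStCharTSUpTrU2Chart
open Summit.HodgeConjecture.HodgeConjecture.Cruxes.H413.F0P3cIwahoriDatumU2
open Summit.HodgeConjecture.HodgeConjecture.Cruxes.H413.F0P3cStCharTSUpTrU2Levels
open scoped MatrixGroups Pointwise

namespace Summit.HodgeConjecture.HodgeConjecture.Cruxes.H413.F0P3cStCharTSUpTrU2BoxProduct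

section Shapes

variable {K : Type*} [Field K] (σ : K →+* K) {J : Matrix (Fin 2) (Fin 2) K} (hJ : J = (StdForm.antidiagonal 2).over K)

/-! ## §1 Shapes: skew coordinates, products, inverses -/

include hJ in
/-- The coordinate of an upper shape `x = u(y)` is `σ`-skew: `y + σ y = 0` (the `(1,1)` unitarity relation of ★ `mem_unitaryGroupOfForm_two_iff`). [cite: Rogawski1990, §1.10 p. 9] -/
theorem add_map_eq_zero_of_coe_eq_upper {x : ↥(unitaryGroupOfForm σ J)} {y : K} (hx : ((x : GL (Fin 2) K) : Matrix (Fin 2) (Fin 2) K) = !![1, y; 0, 1]) :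
    y + σ y = 0 := by
  obtain ⟨-, -, -, h11⟩ := (mem_unitaryGroupOfForm_two_iff σ hJ (x : GL (Fin 2) K)).1 x.2
  simp only [hx, of_apply, cons_val', cons_val_zero, cons_val_one, cons_val_fin_one, empty_val', map_one, one_mul, mul_one] at h11
  linear_combination h11

include hJ in
/-- The coordinate of a lower shape `x = ū(z)` is `σ`-skew: `z + σ z = 0`. [cite: Rogawski1990, §1.10 p. 9] -/
theorem add_map_eq_zero_of_coe_eq_lower {x : ↥(unitaryGroupOfForm σ J)} {z : K} (hx : ((x : GL (Fin 2) K) : Matrix (Fin 2) (Fin 2) K) = !![1, 0; z, 1]) :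
    z + σ z = 0 := by
  obtain ⟨h00, -, -, -⟩ := (mem_unitaryGroupOfForm_two_iff σ hJ (x : GL (Fin 2) K)).1 x.2
  simp only [hx, of_apply, cons_val', cons_val_zero, cons_val_one, cons_val_fin_one, empty_val', map_one, one_mul, mul_one] at h00
  linear_combination h00

/-- Product of two upper shapes: `u(y) u(y′) = u(y + y′)`. [cite: Rogawski1990, §1.10 p. 9] -/
theorem coe_mul_of_coe_eq_upper {x x' : ↥(unitaryGroupOfForm σ J)} {y y' : K}
    (hx : ((x : GL (Fin 2) K) : Matrix (Fin 2) (Fin 2) K) = !![1, y; 0, 1]) (hx' : ((x' : GL (Fin 2) K) : Matrix (Fin 2) (Fin 2) K) = !![1, y'; 0, 1]) :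
    (((x * x' : ↥(unitaryGroupOfForm σ J)) : GL (Fin 2) K) : Matrix (Fin 2) (Fin 2) K) = !![1, y + y'; 0, 1] := by
  rw [Subgroup.coe_mul, Units.val_mul, hx, hx', Matrix.mul_fin_two]
  ext i j; fin_cases i <;> fin_cases j <;> simp [add_comm]

/-- Product of two lower shapes: `ū(z) ū(z′) = ū(z + z′)`. [cite: Rogawski1990, §1.10 p. 9] -/
theorem coe_mul_of_coe_eq_lower {x x' : ↥(unitaryGroupOfForm σ J)} {z z' : K}
    (hx : ((x : GL (Fin 2) K) : Matrix (Fin 2) (Fin 2) K) = !![1, 0; z, 1]) (hx' : ((x' : GL (Fin 2) K) : Matrix (Fin 2) (Fin 2) K) = !![1, 0; z', 1]) :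
    (((x * x' : ↥(unitaryGroupOfForm σ J)) : GL (Fin 2) K) : Matrix (Fin 2) (Fin 2) K) = !![1, 0; z + z', 1] := by
  rw [Subgroup.coe_mul, Units.val_mul, hx, hx', Matrix.mul_fin_two]
  ext i j; fin_cases i <;> fin_cases j <;> simp [add_comm]

include hJ in
/-- Inverse of an upper shape: `u(y)⁻¹ = u(−y)` (★ `coe_inv_eq_of_mem` and `σ y = −y`). [cite: Rogawski1990, §1.10 p. 9] -/
theorem coe_inv_of_coe_eq_upper {x : ↥(unitaryGroupOfForm σ J)} {y : K} (hx : ((x : GL (Fin 2) K) : Matrix (Fin 2) (Fin 2) K) = !![1, y; 0, 1]) :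
    (((x⁻¹ : ↥(unitaryGroupOfForm σ J)) : GL (Fin 2) K) : Matrix (Fin 2) (Fin 2) K) = !![1, -y; 0, 1] := by
  have hσy : σ y = -y := by linear_combination add_map_eq_zero_of_coe_eq_upper σ hJ hx
  rw [Subgroup.coe_inv, coe_inv_eq_of_mem σ hJ x.2, hx]
  ext i j; fin_cases i <;> fin_cases j <;> simp [hσy]

include hJ in
/-- Inverse of a lower shape: `ū(z)⁻¹ = ū(−z)`. [cite: Rogawski1990, §1.10 p. 9] -/
theorem coe_inv_of_coe_eq_lower {x : ↥(unitaryGroupOfForm σ J)} {z : K} (hx : ((x : GL (Fin 2) K) : Matrix (Fin 2) (Fin 2) K) = !![1, 0; z, 1]) :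
    (((x⁻¹ : ↥(unitaryGroupOfForm σ J)) : GL (Fin 2) K) : Matrix (Fin 2) (Fin 2) K) = !![1, 0; -z, 1] := by
  have hσz : σ z = -z := by linear_combination add_map_eq_zero_of_coe_eq_lower σ hJ hx
  rw [Subgroup.coe_inv, coe_inv_eq_of_mem σ hJ x.2, hx]
  ext i j; fin_cases i <;> fin_cases j <;> simp [hσz]

end Shapes

section Valued

variable {K : Type*} [Field K] [ValuativeRel K] (σ : K →+* K) (hσv : ∀ x, valuation K (σ x) = valuation K x)
  {J : Matrix (Fin 2) (Fin 2) K} (hJ : J = (StdForm.antidiagonal 2).over K)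

/-- The diagonal entries of a torus element of level `δ < 1` are units of valuation one: `v(m₀₀) = 1`, `v(m₁₁) = 1`. [cite: Casselman1995, Prop. 1.4.4] -/
theorem valuation_entry_eq_one_of_mem_torusLevel {δ : ValueGroupWithZero K} (hδ : δ < 1) {m : ↥(unitaryGroupOfForm σ J)}
    (hmK : (m : GL (Fin 2) K) ∈ congruenceGL 2 δ) (i : Fin 2) :
    valuation K (((m : GL (Fin 2) K) : Matrix (Fin 2) (Fin 2) K) i i) = 1 := by
  obtain ⟨-, h2, -⟩ := mem_congruenceGL_iff.1 hmK
  have hi := h2 i i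
  rw [Matrix.sub_apply, Matrix.one_apply_eq] at hi
  have h' : ((m : GL (Fin 2) K) : Matrix (Fin 2) (Fin 2) K) i i = 1 + ((((m : GL (Fin 2) K) : Matrix (Fin 2) (Fin 2) K) i i) - 1) := by ring
  rw [h', Valuation.map_add_eq_of_lt_left] <;> rw [Valuation.map_one]
  exact lt_of_le_of_lt hi hδ

/-! ## §2 The torus twists preserve the boxes -/

include hJ hσv in
/-- **`m · u · m⁻¹ ∈ N[r]` for `u ∈ N[r]` and `m` in the torus level `M_δ`, `δ < 1`** (★ (B1) twist with `m⁻¹`: the coordinate is multiplied by `σ(e′)·e′`, `e′ = (m⁻¹)₁₁`, of valuation one).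
[cite: Casselman1995, Prop. 1.4.4] [cite: HarishChandra1970, Lemma 22] -/
theorem conj_mem_upperBox_of_mem_torusLevel {δ r : ValueGroupWithZero K} (hδ : δ < 1) {m u : ↥(unitaryGroupOfForm σ J)}
    (hm : m ∈ torusU σ J) (hmK : (m : GL (Fin 2) K) ∈ congruenceGL 2 δ)
    (hu : ((u : GL (Fin 2) K) : Matrix (Fin 2) (Fin 2) K) = !![1, ((u : GL (Fin 2) K) : Matrix (Fin 2) (Fin 2) K) 0 1; 0, 1] ∧
      valuation K (((u : GL (Fin 2) K) : Matrix (Fin 2) (Fin 2) K) 0 1) ≤ r) :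
    (((m * u * m⁻¹ : ↥(unitaryGroupOfForm σ J)) : GL (Fin 2) K) : Matrix (Fin 2) (Fin 2) K) =
        !![1, (((m * u * m⁻¹ : ↥(unitaryGroupOfForm σ J)) : GL (Fin 2) K) : Matrix (Fin 2) (Fin 2) K) 0 1; 0, 1] ∧
      valuation K ((((m * u * m⁻¹ : ↥(unitaryGroupOfForm σ J)) : GL (Fin 2) K) : Matrix (Fin 2) (Fin 2) K) 0 1) ≤ r := by
  have hm' : m⁻¹ ∈ torusU σ J := (torusU σ J).inv_mem hm
  have htw := coe_inv_mul_mul_of_mem_torusU_of_eq_upper σ hJ hm' hu.1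
  rw [inv_inv] at htw
  -- the twisting unit `e′ = (m⁻¹)₁₁` has valuation one
  have hmK' : ((m⁻¹ : ↥(unitaryGroupOfForm σ J)) : GL (Fin 2) K) ∈ congruenceGL 2 δ := by
    rw [Subgroup.coe_inv]; exact (congruenceGL 2 δ).inv_mem hmK
  have he : valuation K ((((m⁻¹ : ↥(unitaryGroupOfForm σ J)) : GL (Fin 2) K) : Matrix (Fin 2) (Fin 2) K) 1 1) = 1 :=
    valuation_entry_eq_one_of_mem_torusLevel σ hδ hmK' 1
  have h01 : (((m * u * m⁻¹ : ↥(unitaryGroupOfForm σ J)) : GL (Fin 2) K) : Matrix (Fin 2) (Fin 2) K) 0 1 =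
      σ ((((m⁻¹ : ↥(unitaryGroupOfForm σ J)) : GL (Fin 2) K) : Matrix (Fin 2) (Fin 2) K) 1 1) * (((u : GL (Fin 2) K) : Matrix (Fin 2) (Fin 2) K) 0 1) *
        ((((m⁻¹ : ↥(unitaryGroupOfForm σ J)) : GL (Fin 2) K) : Matrix (Fin 2) (Fin 2) K) 1 1) := by
    rw [htw]; simp
  refine ⟨?_, ?_⟩
  · rw [h01, htw]
  · rw [h01, Valuation.map_mul, Valuation.map_mul, hσv, he, one_mul, mul_one]
    exact hu.2

include hJ hσv in
/-- **`m · ū · m⁻¹ ∈ N̄[r]` for `ū ∈ N̄[r]` and `m` in the torus level `M_δ`, `δ < 1`** (★ (B1) lower twist; modulus `v(σ(d′)·d′) = 1`). [cite: Casselman1995, Prop. 1.4.4] -/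
theorem conj_mem_lowerBox_of_mem_torusLevel {δ r : ValueGroupWithZero K} (hδ : δ < 1) {m u : ↥(unitaryGroupOfForm σ J)}
    (hm : m ∈ torusU σ J) (hmK : (m : GL (Fin 2) K) ∈ congruenceGL 2 δ)
    (hu : ((u : GL (Fin 2) K) : Matrix (Fin 2) (Fin 2) K) = !![1, 0; ((u : GL (Fin 2) K) : Matrix (Fin 2) (Fin 2) K) 1 0, 1] ∧
      valuation K (((u : GL (Fin 2) K) : Matrix (Fin 2) (Fin 2) K) 1 0) ≤ r) :
    (((m * u * m⁻¹ : ↥(unitaryGroupOfForm σ J)) : GL (Fin 2) K) : Matrix (Fin 2) (Fin 2) K) =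
        !![1, 0; (((m * u * m⁻¹ : ↥(unitaryGroupOfForm σ J)) : GL (Fin 2) K) : Matrix (Fin 2) (Fin 2) K) 1 0, 1] ∧
      valuation K ((((m * u * m⁻¹ : ↥(unitaryGroupOfForm σ J)) : GL (Fin 2) K) : Matrix (Fin 2) (Fin 2) K) 1 0) ≤ r := by
  have hm' : m⁻¹ ∈ torusU σ J := (torusU σ J).inv_mem hm
  have htw := coe_inv_mul_mul_of_mem_torusU_of_eq_lower σ hJ hm' hu.1
  rw [inv_inv] at htw
  have hmK' : ((m⁻¹ : ↥(unitaryGroupOfForm σ J)) : GL (Fin 2) K) ∈ congruenceGL 2 δ := by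
    rw [Subgroup.coe_inv]; exact (congruenceGL 2 δ).inv_mem hmK
  have hd : valuation K ((((m⁻¹ : ↥(unitaryGroupOfForm σ J)) : GL (Fin 2) K) : Matrix (Fin 2) (Fin 2) K) 0 0) = 1 :=
    valuation_entry_eq_one_of_mem_torusLevel σ hδ hmK' 0
  have h10 : (((m * u * m⁻¹ : ↥(unitaryGroupOfForm σ J)) : GL (Fin 2) K) : Matrix (Fin 2) (Fin 2) K) 1 0 =
      σ ((((m⁻¹ : ↥(unitaryGroupOfForm σ J)) : GL (Fin 2) K) : Matrix (Fin 2) (Fin 2) K) 0 0) * (((u : GL (Fin 2) K) : Matrix (Fin 2) (Fin 2) K) 1 0) *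
        ((((m⁻¹ : ↥(unitaryGroupOfForm σ J)) : GL (Fin 2) K) : Matrix (Fin 2) (Fin 2) K) 0 0) := by
    rw [htw]; simp
  refine ⟨?_, ?_⟩
  · rw [h10, htw]
  · rw [h10, Valuation.map_mul, Valuation.map_mul, hσv, hd, one_mul, mul_one]
    exact hu.2

omit [ValuativeRel K] in
/-- Entry extraction for a lower shape: `↑↑x = ū(z)` gives the self-referential shape and `x₁₀ = z`. [cite: Rogawski1990, §1.10 p. 9] -/
theorem shape_of_coe_eq_lower {x : ↥(unitaryGroupOfForm σ J)} {z : K} (hx : ((x : GL (Fin 2) K) : Matrix (Fin 2) (Fin 2) K) = !![1, 0; z, 1]) :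
    ((x : GL (Fin 2) K) : Matrix (Fin 2) (Fin 2) K) = !![1, 0; ((x : GL (Fin 2) K) : Matrix (Fin 2) (Fin 2) K) 1 0, 1] ∧
      ((x : GL (Fin 2) K) : Matrix (Fin 2) (Fin 2) K) 1 0 = z := by
  have h10 : ((x : GL (Fin 2) K) : Matrix (Fin 2) (Fin 2) K) 1 0 = z := by rw [hx]; simp
  exact ⟨by rw [h10, hx], h10⟩

omit [ValuativeRel K] in
/-- Entry extraction for an upper shape: `↑↑x = u(y)` gives the self-referential shape and `x₀₁ = y`. [cite: Rogawski1990, §1.10 p. 9] -/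
theorem shape_of_coe_eq_upper {x : ↥(unitaryGroupOfForm σ J)} {y : K} (hx : ((x : GL (Fin 2) K) : Matrix (Fin 2) (Fin 2) K) = !![1, y; 0, 1]) :
    ((x : GL (Fin 2) K) : Matrix (Fin 2) (Fin 2) K) = !![1, ((x : GL (Fin 2) K) : Matrix (Fin 2) (Fin 2) K) 0 1; 0, 1] ∧
      ((x : GL (Fin 2) K) : Matrix (Fin 2) (Fin 2) K) 0 1 = y := by
  have h01 : ((x : GL (Fin 2) K) : Matrix (Fin 2) (Fin 2) K) 0 1 = y := by rw [hx]; simp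
  exact ⟨by rw [h01, hx], h01⟩

/-! ## §3 The refactorisation `u(y) · ū(z) = ū(z p′) · m(1 + yz, 1 − z p′ y) · u(p′ y)` inside `U′` -/

include hJ in
/-- **THE REFACTORISATION OF `N · N̄` INTO `N̄ · M · N` WITH BOUNDS.**  For `u ∈ N[r₂]`, `ū ∈ N̄[r₁]` with `r₁ r₂ ≤ δ < 1`: `u ū = n̄′ m′ n′` with `n̄′ ∈ N̄[r₁]`, `m′ ∈ M_δ`, `n′ ∈ N[r₂]`
(`y = u₀₁`, `z = ū₁₀`, `t = yz`, `v(t) ≤ δ < 1`, `p = 1 + t` a `σ`-fixed unit, `p′ p = 1`: `u(y)ū(z) = [[p, y],[z, 1]] = ū(z p′)·m(p, 1 − z p′ y)·u(p′ y)` by ★ (B1) `upper_mul_lower` +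
`eq_lower_mul_diag_mul_upper`, the three factors unitary by ★ (B1) `exists_lower ∕ exists_diag ∕ exists_upper` since `y, z` are skew and `p` is fixed; `v(z p′) = v(z)`, `v(p′ y) = v(y)`,
`v(p − 1) = v(1 − z p′ y − 1) = v(t) ≤ δ`). [cite: Casselman1995, Prop. 1.4.4] [cite: BruhatTits1972, (4.4.3)] -/
theorem exists_refactor_upper_mul_lower {δ r₁ r₂ : ValueGroupWithZero K} (hδ : δ < 1) (hr : r₁ * r₂ ≤ δ) {u ub : ↥(unitaryGroupOfForm σ J)}
    (hu : ((u : GL (Fin 2) K) : Matrix (Fin 2) (Fin 2) K) = !![1, ((u : GL (Fin 2) K) : Matrix (Fin 2) (Fin 2) K) 0 1; 0, 1] ∧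
      valuation K (((u : GL (Fin 2) K) : Matrix (Fin 2) (Fin 2) K) 0 1) ≤ r₂)
    (hub : ((ub : GL (Fin 2) K) : Matrix (Fin 2) (Fin 2) K) = !![1, 0; ((ub : GL (Fin 2) K) : Matrix (Fin 2) (Fin 2) K) 1 0, 1] ∧
      valuation K (((ub : GL (Fin 2) K) : Matrix (Fin 2) (Fin 2) K) 1 0) ≤ r₁) :
    ∃ nb m n : ↥(unitaryGroupOfForm σ J),
      (((nb : GL (Fin 2) K) : Matrix (Fin 2) (Fin 2) K) = !![1, 0; ((nb : GL (Fin 2) K) : Matrix (Fin 2) (Fin 2) K) 1 0, 1] ∧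
          valuation K (((nb : GL (Fin 2) K) : Matrix (Fin 2) (Fin 2) K) 1 0) ≤ r₁) ∧
        (m ∈ torusU σ J ∧ (m : GL (Fin 2) K) ∈ congruenceGL 2 δ) ∧
        (((n : GL (Fin 2) K) : Matrix (Fin 2) (Fin 2) K) = !![1, ((n : GL (Fin 2) K) : Matrix (Fin 2) (Fin 2) K) 0 1; 0, 1] ∧
          valuation K (((n : GL (Fin 2) K) : Matrix (Fin 2) (Fin 2) K) 0 1) ≤ r₂) ∧
        u * ub = nb * m * n := by
  set y : K := ((u : GL (Fin 2) K) : Matrix (Fin 2) (Fin 2) K) 0 1 with hy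
  set z : K := ((ub : GL (Fin 2) K) : Matrix (Fin 2) (Fin 2) K) 1 0 with hz
  have hσy : σ y = -y := by linear_combination add_map_eq_zero_of_coe_eq_upper σ hJ hu.1
  have hσz : σ z = -z := by linear_combination add_map_eq_zero_of_coe_eq_lower σ hJ hub.1
  -- the unit `p = 1 + y z`
  have hvt : valuation K (y * z) ≤ δ := by
    rw [Valuation.map_mul, mul_comm]
    exact (mul_le_mul' hub.2 hu.2).trans hr
  have hvt1 : valuation K (y * z) < 1 := lt_of_le_of_lt hvt hδ
  have hvp : valuation K (1 + y * z) = 1 := by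
    rw [Valuation.map_add_eq_of_lt_left] <;> rw [Valuation.map_one]; exact hvt1
  have hp0 : 1 + y * z ≠ 0 := fun h => by rw [h, Valuation.map_zero] at hvp; exact zero_ne_one hvp
  set p' : K := (1 + y * z)⁻¹ with hp'
  have hp'p : p' * (1 + y * z) = 1 := inv_mul_cancel₀ hp0
  have hpp' : (1 + y * z) * p' = 1 := mul_inv_cancel₀ hp0
  have hvp' : valuation K p' = 1 := by rw [hp', map_inv₀, hvp, inv_one]
  have hσp : σ (1 + y * z) = 1 + y * z := by rw [map_add, map_one, map_mul, hσy, hσz, neg_mul_neg]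
  have hσp' : σ p' = p' := by rw [hp', map_inv₀, hσp]
  -- the three factors, as elements of `U′`
  obtain ⟨nb, hnb, -⟩ := exists_lower σ hJ (z := z * p') (by rw [map_mul, hσz, hσp']; ring)
  have he : σ (1 + y * z) * (1 - z * p' * y) = 1 := by
    rw [hσp]; linear_combination (-(y * z)) * hpp'
  have he' : σ (1 - z * p' * y) * (1 + y * z) = 1 := by
    rw [map_sub, map_one, map_mul, map_mul, hσz, hσp', hσy]; linear_combination -(y * z * hpp')
  obtain ⟨m, hm, hmi⟩ := exists_diag σ hJ he he'
  obtain ⟨n, hn, -⟩ := exists_upper σ hJ (y := p' * y) (by rw [map_mul, hσp', hσy]; ring)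
  -- the product identity in `U′`
  have hprod : u * ub = nb * m * n := by
    apply Subtype.ext; apply Units.ext
    rw [Subgroup.coe_mul, Units.val_mul, hu.1, hub.1, upper_mul_lower, Subgroup.coe_mul, Subgroup.coe_mul, Units.val_mul, Units.val_mul,
      hnb, hm, hn]
    exact eq_lower_mul_diag_mul_upper (1 + y * z) y z 1 p' hp'p
  -- valuations of the new coordinates
  have hvzp : valuation K (z * p') ≤ r₁ := by rw [Valuation.map_mul, hvp', mul_one]; exact hub.2
  have hvpy : valuation K (p' * y) ≤ r₂ := by rw [Valuation.map_mul, hvp', one_mul]; exact hu.2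
  have hve1 : valuation K (1 - z * p' * y - 1) ≤ δ := by
    have : (1 : K) - z * p' * y - 1 = -(p' * (y * z)) := by ring
    rw [this, Valuation.map_neg, Valuation.map_mul, hvp', one_mul]; exact hvt
  have hve : valuation K (1 - z * p' * y) = 1 := by
    have h' : (1 : K) - z * p' * y = 1 + (-(p' * (y * z))) := by ring
    rw [h', Valuation.map_add_eq_of_lt_left] <;> rw [Valuation.map_one]
    rw [Valuation.map_neg, Valuation.map_mul, hvp', one_mul]; exact hvt1
  have he0 : (1 : K) - z * p' * y ≠ 0 := fun h => by rw [h, Valuation.map_zero] at hve; exact zero_ne_one hve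
  -- `m ∈ M`: a diagonal of units
  have hmT : m ∈ torusU σ J := by
    rw [mem_torusU_iff]
    refine ⟨![Units.mk0 _ hp0, Units.mk0 _ he0], Units.ext ?_⟩
    rw [coe_glDiagonal, hm]
    ext i j; fin_cases i <;> fin_cases j <;> simp
  -- `↑m ∈ K_δ`: entries (the inverse matrix `m(σe, σp) = m(e, p)` since `σ` fixes `p` and `e`)
  have hmK : (m : GL (Fin 2) K) ∈ congruenceGL 2 δ := by
    have hσe : σ (1 - z * p' * y) = 1 - z * p' * y := by
      rw [map_sub, map_one, map_mul, map_mul, hσz, hσp', hσy]; ring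
    have hmi' : (((m : GL (Fin 2) K)⁻¹ : GL (Fin 2) K) : Matrix (Fin 2) (Fin 2) K) = !![1 - z * p' * y, 0; 0, 1 + y * z] := by
      rw [hmi, hσe, hσp]
    have hvp1 : valuation K (1 + y * z - 1) ≤ δ := by rw [add_sub_cancel_left]; exact hvt
    have hvzpy : valuation K (z * p' * y) ≤ δ := by
      have : z * p' * y = p' * (y * z) := by ring
      rw [this, Valuation.map_mul, hvp', one_mul]; exact hvt
    have hvp_le : valuation K (1 + y * z) ≤ 1 := hvp.le
    have hve_le : valuation K (1 - z * p' * y) ≤ 1 := hve.le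
    refine mem_congruenceGL_iff.2 ⟨⟨fun i j => ?_, fun i j => ?_⟩, fun i j => ?_, fun i j => ?_⟩
    · rw [hm]
      fin_cases i <;> fin_cases j
      · exact hvp_le
      · simp
      · simp
      · exact hve_le
    · rw [hmi']
      fin_cases i <;> fin_cases j
      · exact hve_le
      · simp
      · simp
      · exact hvp_le
    · rw [hm, Matrix.one_fin_two]
      fin_cases i <;> fin_cases j
      · simpa using hvp1
      · simp
      · simp
      · simpa using hve1
    · rw [hmi', Matrix.one_fin_two]
      fin_cases i <;> fin_cases j
      · simpa using hve1
      · simp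
      · simp
      · simpa using hvp1
  refine ⟨nb, m, n, ⟨(shape_of_coe_eq_lower σ hnb).1, ?_⟩, ⟨hmT, hmK⟩, ⟨(shape_of_coe_eq_upper σ hn).1, ?_⟩, hprod⟩
  · rw [(shape_of_coe_eq_lower σ hnb).2]; exact hvzp
  · rw [(shape_of_coe_eq_upper σ hn).2]; exact hvpy

/-! ## §4 The Iwahori-type product `P(r₁, δ, r₂) = N̄[r₁] · M_δ · N[r₂]` is a subgroup -/

include hJ hσv in
/-- **THE IWAHORI-TYPE BOX PRODUCT IS A SUBGROUP.**  For `δ < 1` and radii with `r₁ r₂ ≤ δ` (no other bound), the bare product `N̄[r₁] · M_δ · N[r₂]` of the lower box, the torus level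
and the upper box of `U(σ, Φ₂)(K)` is the carrier of a subgroup `P(r₁, δ, r₂)` (closure: refactor the middle `N · N̄` by §3 and push the torus factors outward with the twists of §2;
inverses likewise).  At `r₁ = r₂ = δ = γ` this is `K_γ ∩ U′` (★ `F0P3cIwahoriDatumU2Alg.coe_level_eq_mul`); the (B5) sandwich is `P(γ·v(a−1), γ, γ·v(a⁻¹−1))`.
[cite: Casselman1995, Prop. 1.4.4] [cite: BruhatTits1972, (4.4.3)–(4.4.4), §6.4] -/
theorem exists_subgroup_coe_eq_boxProduct {δ r₁ r₂ : ValueGroupWithZero K} (hδ : δ < 1) (hr : r₁ * r₂ ≤ δ) :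
    ∃ P : Subgroup ↥(unitaryGroupOfForm σ J), (P : Set ↥(unitaryGroupOfForm σ J)) =
      {x : ↥(unitaryGroupOfForm σ J) | ((x : GL (Fin 2) K) : Matrix (Fin 2) (Fin 2) K) = !![1, 0; ((x : GL (Fin 2) K) : Matrix (Fin 2) (Fin 2) K) 1 0, 1] ∧
          valuation K (((x : GL (Fin 2) K) : Matrix (Fin 2) (Fin 2) K) 1 0) ≤ r₁} *
        {m : ↥(unitaryGroupOfForm σ J) | m ∈ torusU σ J ∧ (m : GL (Fin 2) K) ∈ congruenceGL 2 δ} *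
        {x : ↥(unitaryGroupOfForm σ J) | ((x : GL (Fin 2) K) : Matrix (Fin 2) (Fin 2) K) = !![1, ((x : GL (Fin 2) K) : Matrix (Fin 2) (Fin 2) K) 0 1; 0, 1] ∧
          valuation K (((x : GL (Fin 2) K) : Matrix (Fin 2) (Fin 2) K) 0 1) ≤ r₂} := by
  -- closure of the two boxes under products (ultrametric) — as local facts
  have hlow_mul : ∀ {a a' : ↥(unitaryGroupOfForm σ J)},
      (((a : GL (Fin 2) K) : Matrix (Fin 2) (Fin 2) K) = !![1, 0; ((a : GL (Fin 2) K) : Matrix (Fin 2) (Fin 2) K) 1 0, 1] ∧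
        valuation K (((a : GL (Fin 2) K) : Matrix (Fin 2) (Fin 2) K) 1 0) ≤ r₁) →
      (((a' : GL (Fin 2) K) : Matrix (Fin 2) (Fin 2) K) = !![1, 0; ((a' : GL (Fin 2) K) : Matrix (Fin 2) (Fin 2) K) 1 0, 1] ∧
        valuation K (((a' : GL (Fin 2) K) : Matrix (Fin 2) (Fin 2) K) 1 0) ≤ r₁) →
      (((a * a' : ↥(unitaryGroupOfForm σ J)) : GL (Fin 2) K) : Matrix (Fin 2) (Fin 2) K) =
          !![1, 0; (((a * a' : ↥(unitaryGroupOfForm σ J)) : GL (Fin 2) K) : Matrix (Fin 2) (Fin 2) K) 1 0, 1] ∧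
        valuation K ((((a * a' : ↥(unitaryGroupOfForm σ J)) : GL (Fin 2) K) : Matrix (Fin 2) (Fin 2) K) 1 0) ≤ r₁ := by
    intro a a' ha ha'
    have hm := coe_mul_of_coe_eq_lower σ ha.1 ha'.1
    refine ⟨(shape_of_coe_eq_lower σ hm).1, ?_⟩
    rw [(shape_of_coe_eq_lower σ hm).2]
    exact (Valuation.map_add _ _ _).trans (max_le ha.2 ha'.2)
  have hup_mul : ∀ {c c' : ↥(unitaryGroupOfForm σ J)},
      (((c : GL (Fin 2) K) : Matrix (Fin 2) (Fin 2) K) = !![1, ((c : GL (Fin 2) K) : Matrix (Fin 2) (Fin 2) K) 0 1; 0, 1] ∧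
        valuation K (((c : GL (Fin 2) K) : Matrix (Fin 2) (Fin 2) K) 0 1) ≤ r₂) →
      (((c' : GL (Fin 2) K) : Matrix (Fin 2) (Fin 2) K) = !![1, ((c' : GL (Fin 2) K) : Matrix (Fin 2) (Fin 2) K) 0 1; 0, 1] ∧
        valuation K (((c' : GL (Fin 2) K) : Matrix (Fin 2) (Fin 2) K) 0 1) ≤ r₂) →
      (((c * c' : ↥(unitaryGroupOfForm σ J)) : GL (Fin 2) K) : Matrix (Fin 2) (Fin 2) K) =
          !![1, (((c * c' : ↥(unitaryGroupOfForm σ J)) : GL (Fin 2) K) : Matrix (Fin 2) (Fin 2) K) 0 1; 0, 1] ∧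
        valuation K ((((c * c' : ↥(unitaryGroupOfForm σ J)) : GL (Fin 2) K) : Matrix (Fin 2) (Fin 2) K) 0 1) ≤ r₂ := by
    intro c c' hc hc'
    have hm := coe_mul_of_coe_eq_upper σ hc.1 hc'.1
    refine ⟨(shape_of_coe_eq_upper σ hm).1, ?_⟩
    rw [(shape_of_coe_eq_upper σ hm).2]
    exact (Valuation.map_add _ _ _).trans (max_le hc.2 hc'.2)
  refine ⟨{ carrier := _, mul_mem' := ?_, one_mem' := ?_, inv_mem' := ?_ }, rfl⟩
  · -- closure under multiplication
    rintro _ _ ⟨_, ⟨a, ha, b, hb, rfl⟩, c, hc, rfl⟩ ⟨_, ⟨a', ha', b', hb', rfl⟩, c', hc', rfl⟩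
    obtain ⟨nb, m, n, hnb, hm, hn, hkey⟩ := exists_refactor_upper_mul_lower σ hJ hδ hr hc ha'
    have hb_inv : b⁻¹ ∈ torusU σ J ∧ ((b⁻¹ : ↥(unitaryGroupOfForm σ J)) : GL (Fin 2) K) ∈ congruenceGL 2 δ :=
      ⟨(torusU σ J).inv_mem hb.1, by rw [Subgroup.coe_inv]; exact (congruenceGL 2 δ).inv_mem hb.2⟩
    have hb'_inv : b'⁻¹ ∈ torusU σ J ∧ ((b'⁻¹ : ↥(unitaryGroupOfForm σ J)) : GL (Fin 2) K) ∈ congruenceGL 2 δ :=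
      ⟨(torusU σ J).inv_mem hb'.1, by rw [Subgroup.coe_inv]; exact (congruenceGL 2 δ).inv_mem hb'.2⟩
    have h1 : _ := conj_mem_lowerBox_of_mem_torusLevel σ hσv hJ hδ hb.1 hb.2 hnb
    have h3 : _ := conj_mem_upperBox_of_mem_torusLevel σ hσv hJ hδ hb'_inv.1 hb'_inv.2 hn
    rw [inv_inv] at h3
    refine Set.mem_mul.2 ⟨(a * (b * nb * b⁻¹)) * (b * m * b'), Set.mem_mul.2 ⟨a * (b * nb * b⁻¹), hlow_mul ha h1, b * m * b', ⟨?_, ?_⟩, rfl⟩,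
      (b'⁻¹ * n * b') * c', hup_mul h3 hc', ?_⟩
    · exact (torusU σ J).mul_mem ((torusU σ J).mul_mem hb.1 hm.1) hb'.1
    · rw [Subgroup.coe_mul, Subgroup.coe_mul]
      exact (congruenceGL 2 δ).mul_mem ((congruenceGL 2 δ).mul_mem hb.2 hm.2) hb'.2
    · calc a * (b * nb * b⁻¹) * (b * m * b') * (b'⁻¹ * n * b' * c') = a * b * (nb * m * n) * (b' * c') := by group
        _ = a * b * (c * a') * (b' * c') := by rw [hkey]
        _ = a * b * c * (a' * b' * c') := by group
  · -- `1 = ū(0) · 1 · u(0)`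
    have h1 : (((1 : ↥(unitaryGroupOfForm σ J)) : GL (Fin 2) K) : Matrix (Fin 2) (Fin 2) K) = 1 := by
      rw [Subgroup.coe_one, Units.val_one]
    refine Set.mem_mul.2 ⟨1 * 1, Set.mem_mul.2 ⟨1, ⟨?_, ?_⟩, 1, ⟨(torusU σ J).one_mem, ?_⟩, rfl⟩, 1, ⟨?_, ?_⟩, by rw [mul_one, mul_one]⟩
    · rw [h1]; ext i j; fin_cases i <;> fin_cases j <;> simp
    · rw [h1]; simp
    · rw [Subgroup.coe_one]; exact (congruenceGL 2 δ).one_mem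
    · rw [h1]; ext i j; fin_cases i <;> fin_cases j <;> simp
    · rw [h1]; simp
  · -- closure under inversion
    rintro _ ⟨_, ⟨a, ha, b, hb, rfl⟩, c, hc, rfl⟩
    have hb_inv : b⁻¹ ∈ torusU σ J ∧ ((b⁻¹ : ↥(unitaryGroupOfForm σ J)) : GL (Fin 2) K) ∈ congruenceGL 2 δ :=
      ⟨(torusU σ J).inv_mem hb.1, by rw [Subgroup.coe_inv]; exact (congruenceGL 2 δ).inv_mem hb.2⟩
    -- shapes of the inverses
    have hai : (((a⁻¹ : ↥(unitaryGroupOfForm σ J)) : GL (Fin 2) K) : Matrix (Fin 2) (Fin 2) K) =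
        !![1, 0; (((a⁻¹ : ↥(unitaryGroupOfForm σ J)) : GL (Fin 2) K) : Matrix (Fin 2) (Fin 2) K) 1 0, 1] ∧
        valuation K ((((a⁻¹ : ↥(unitaryGroupOfForm σ J)) : GL (Fin 2) K) : Matrix (Fin 2) (Fin 2) K) 1 0) ≤ r₁ := by
      have hm := coe_inv_of_coe_eq_lower σ hJ ha.1
      refine ⟨(shape_of_coe_eq_lower σ hm).1, ?_⟩
      rw [(shape_of_coe_eq_lower σ hm).2, Valuation.map_neg]; exact ha.2
    have hci : (((c⁻¹ : ↥(unitaryGroupOfForm σ J)) : GL (Fin 2) K) : Matrix (Fin 2) (Fin 2) K) =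
        !![1, (((c⁻¹ : ↥(unitaryGroupOfForm σ J)) : GL (Fin 2) K) : Matrix (Fin 2) (Fin 2) K) 0 1; 0, 1] ∧
        valuation K ((((c⁻¹ : ↥(unitaryGroupOfForm σ J)) : GL (Fin 2) K) : Matrix (Fin 2) (Fin 2) K) 0 1) ≤ r₂ := by
      have hm := coe_inv_of_coe_eq_upper σ hJ hc.1
      refine ⟨(shape_of_coe_eq_upper σ hm).1, ?_⟩
      rw [(shape_of_coe_eq_upper σ hm).2, Valuation.map_neg]; exact hc.2
    -- `w := b⁻¹ a⁻¹ b ∈ N̄[r₁]`, refactor `c⁻¹ w`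
    have hw : _ := conj_mem_lowerBox_of_mem_torusLevel σ hσv hJ hδ hb_inv.1 hb_inv.2 hai
    rw [inv_inv] at hw
    obtain ⟨nb, m, n, hnb, hm, hn, hkey⟩ := exists_refactor_upper_mul_lower σ hJ hδ hr hci hw
    have h3 : _ := conj_mem_upperBox_of_mem_torusLevel σ hσv hJ hδ hb.1 hb.2 hn
    refine Set.mem_mul.2 ⟨nb * (m * b⁻¹), Set.mem_mul.2 ⟨nb, hnb, m * b⁻¹, ⟨(torusU σ J).mul_mem hm.1 hb_inv.1, ?_⟩, rfl⟩,
      b * n * b⁻¹, h3, ?_⟩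
    · rw [Subgroup.coe_mul]; exact (congruenceGL 2 δ).mul_mem hm.2 hb_inv.2
    · calc nb * (m * b⁻¹) * (b * n * b⁻¹) = nb * m * n * b⁻¹ := by group
        _ = c⁻¹ * (b⁻¹ * a⁻¹ * b) * b⁻¹ := by rw [← hkey]
        _ = (a * b * c)⁻¹ := by group

end Valued

end Summit.HodgeConjecture.HodgeConjecture.Cruxes.H413.F0P3cStCharTSUpTrU2BoxProduct
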